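import Summits.CriticalPhenomena.PercolationContinuityZ3.Theorems.PercNearOneGluingNoHeavyLowerTailSahiCombTriWAndOrAnd

/-!
# AND with the block `x₀ ∨ (x₁ ∧ ⋯ ∧ x_k)` for EVERY k: `AndShellLower` by two Kleitman sums (an infinite family, human-readable certificate)

Support file of the one-cut programme (crux `NoHeavyLowerTail`, stmt-CriticalPhenomena-4575; unit `prim-lf-1` gen 45, memo
`FROM-prim-lf-1-gen45-AND-OR3.md` §7).  Continuation of `…SahiCombTriWAndOr2` (k = 1), `…SahiCombTriWAndOrAnd` (k = 2), `…SahiCombTriWAndOrAndThree`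
(k = 3), whose machine certificates suggested the general pattern proved here.

The block.  On `H = Unit ⊕ δ` let `orAndGen δ = orProd {univ} {univ} = {y | y.toLeft = univ ∨ y.toRight = univ}` — the monotone function
`x₀ ∨ ⋀_{j∈δ} x_j`.  Its symmetric core is `S = {(⊤,∅), (∅,⊤)}`, its asymmetric part `E = {(⊤,z) | z ≠ ∅}` (`orAndGen_inter_refl`, `orAndGen_sdiff_refl`).
The certificate (per row `x ∈ P₁`; levels `a¹_z = [x ⊔ (⊤,z) ∈ A]`, `a⁰_z = [x ⊔ (∅,z) ∈ A]`, bars for `xᶜ`, the same for `B`):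
  `row = (a¹_∅−ā¹_∅)(b⁰_⊤−b̄⁰_∅) + (a⁰_⊤−ā⁰_∅)(b¹_∅−b̄¹_∅) + Σ_{z≠∅} (a¹_z−ā⁰_z)(b¹_z−b̄⁰_z)`      (three kinds of K⊗K products: acute)
      `+ (ā¹_∅−ā⁰_∅)(b̄¹_∅−b̄⁰_∅)`                                                                    (N⊗N)
      `+ Σ_z a¹_z (b̄⁰_z − b̄⁰_{zᶜ}) + Σ_z b¹_z (ā⁰_z − ā⁰_{zᶜ})`                                     (two KLEITMAN sums on `2^δ`)
(`row_orAndGen_eq_cert`); the Kleitman sums are `klL univ X Y ≥ 0` for the up-set sections `X = (B_{xᶜ})⁰`, `Y = (A_x)¹` (`klShell_univ`).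
* **`lForm_le_scoreVal_andProd_orAndGen`** — `AndShellLower` for `Q = orAndGen δ` and every antipode-free up-set `P₁` with `Cor_{P₁} ≥ 0`;
* `scoreCert_andProd_orAndGen`, **`triW_nonneg_andProd_orAndGen`** (TriWIneq for `P₁ ∧ (x₀ ∨ x₁⋯x_k)`, every index cube), `…_of_klShell`.
HONEST LABEL: complete proofs, std axioms; an infinite family of blocks (all k ≥ 1); the general conjecture `AndShellLower` stays OPEN. [this work]
-/

namespace Summit.CriticalPhenomena.PercolationContinuityZ3.Theorems

namespace FiveUpSet

open Finset

variable {β γ₁ δ : Type} [DecidableEq β] [Fintype β] [DecidableEq γ₁] [Fintype γ₁] [DecidableEq δ] [Fintype δ]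

/-! ### The block `x₀ ∨ ⋀ x_j` -/

/-- The block `x₀ ∨ (⋀_{j∈δ} x_j)` on `Unit ⊕ δ`: `orProd {univ} {univ}`. [this work] -/
def orAndGen (δ : Type) [DecidableEq δ] [Fintype δ] : Finset (Finset (Unit ⊕ δ)) := orProd {univ} {univ}

omit [DecidableEq δ] in
/-- Membership in `orAndGen`. [this work] -/
theorem mem_orAndGen [DecidableEq δ] {y : Finset (Unit ⊕ δ)} : y ∈ orAndGen δ ↔ y.toLeft = univ ∨ y.toRight = univ := by
  unfold orAndGen; rw [mem_orProd, mem_singleton, mem_singleton]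

/-- A singleton `{univ}` is an up-set. [this work] -/
theorem isUpperSet_singleton_univ {α : Type} [DecidableEq α] [Fintype α] : IsUpperSet (({univ} : Finset (Finset α)) : Set (Finset α)) := by
  intro s t hst hs
  rw [mem_coe, mem_singleton] at hs ⊢
  rw [hs] at hst
  exact univ_subset_iff.1 hst

/-- `orAndGen` is an up-set. [this work] -/
theorem isUpperSet_orAndGen : IsUpperSet (orAndGen δ : Set (Finset (Unit ⊕ δ))) := by
  unfold orAndGen; exact isUpperSet_orProd isUpperSet_singleton_univ isUpperSet_singleton_univ

/-- A subset of `Unit` is `∅` or `univ`. [this work] -/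
theorem finset_unit_cases (s : Finset Unit) : s = univ ∨ s = ∅ := by
  by_cases h : () ∈ s
  · left; ext u; cases u; simp [h]
  · right; ext u; cases u; simp [h]

section structure_lemmas
variable [Nonempty δ]

omit [DecidableEq δ] in
/-- `univ ≠ ∅` in `Finset δ` for non-empty `δ`. [this work] -/
theorem univ_ne_empty_delta [DecidableEq δ] : (univ : Finset δ) ≠ ∅ := univ_nonempty.ne_empty

/-- The symmetric core of `orAndGen`: `{(⊤,∅)} ∪ {(∅,⊤)}`. [this work] -/
theorem orAndGen_inter_refl : orAndGen δ ∩ refl (orAndGen δ) = zProd {univ} {∅} ∪ zProd {∅} {univ} := by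
  ext y
  simp only [mem_inter, mem_refl, mem_orAndGen, mem_union, mem_zProd, mem_singleton, toLeft_compl, toRight_compl, compl_eq_univ_iff]
  have h1 := finset_unit_cases y.toLeft
  have h2 : (univ : Finset Unit) ≠ ∅ := univ_nonempty.ne_empty
  have h3 : (univ : Finset δ) ≠ ∅ := univ_ne_empty_delta
  have h4 : y.toLeft = univ → y.toLeft ≠ ∅ := fun a b => h2 (a.symm.trans b)
  have h5 : y.toRight = univ → y.toRight ≠ ∅ := fun a b => h3 (a.symm.trans b)
  tauto

/-- The asymmetric part of `orAndGen`: `{(⊤,z) | z ≠ ∅}`. [this work] -/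
theorem orAndGen_sdiff_refl : orAndGen δ \ refl (orAndGen δ) = zProd {univ} (univ.erase ∅) := by
  ext y
  simp only [mem_sdiff, mem_refl, mem_orAndGen, mem_zProd, mem_singleton, mem_erase, mem_univ, and_true, toLeft_compl, toRight_compl,
    compl_eq_univ_iff]
  have h1 := finset_unit_cases y.toLeft
  have h2 : (univ : Finset Unit) ≠ ∅ := univ_nonempty.ne_empty
  have h3 : (univ : Finset δ) ≠ ∅ := univ_ne_empty_delta
  have h4 : y.toLeft = univ → y.toLeft ≠ ∅ := fun a b => h2 (a.symm.trans b)
  have h5 : y.toRight = univ → y.toRight ≠ ∅ := fun a b => h3 (a.symm.trans b)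
  tauto

omit [Nonempty δ] in
/-- The antipodal image of `orAndGen`: `{(∅,z)} ∪ {(⊤,∅)}`. [this work] -/
theorem refl_orAndGen : refl (orAndGen δ) = zProd {∅} univ ∪ zProd {univ} {∅} := by
  ext y
  simp only [mem_refl, mem_orAndGen, mem_union, mem_zProd, mem_singleton, mem_univ, and_true, toLeft_compl, toRight_compl, compl_eq_univ_iff]
  have h1 := finset_unit_cases y.toLeft
  have h2 : (univ : Finset Unit) ≠ ∅ := univ_nonempty.ne_empty
  have h4 : y.toLeft = univ → y.toLeft ≠ ∅ := fun a b => h2 (a.symm.trans b)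
  tauto

omit [Nonempty δ] in
/-- `orAndGen` as a union of rows. [this work] -/
theorem orAndGen_eq_union : orAndGen δ = zProd {univ} univ ∪ zProd {∅} {univ} := by
  ext y
  simp only [mem_orAndGen, mem_union, mem_zProd, mem_singleton, mem_univ, and_true]
  have h1 := finset_unit_cases y.toLeft
  tauto

omit [Nonempty δ] in
/-- Rows at different `Unit`-levels are disjoint. [this work] -/
theorem disjoint_zProd_levels (Z Z' : Finset (Finset δ)) : Disjoint (zProd ({univ} : Finset (Finset Unit)) Z) (zProd {∅} Z') := by
  rw [disjoint_left]
  intro y h h'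
  rw [mem_zProd, mem_singleton] at h h'
  exact univ_nonempty.ne_empty (h.1.symm.trans h'.1)

end structure_lemmas

/-! ### Level indicators and the per-row bookkeeping -/

section rows
variable [Nonempty δ] (A B : Finset (Finset (γ₁ ⊕ (Unit ⊕ δ)))) (x : Finset γ₁)

omit [Fintype γ₁] in
/-- Score row: `#(S ∩ B_x ∩ refl A_x) + #(E ∩ A_x ∩ B_x)` in level indicators. [this work] -/
theorem score_row_orAndGen :
    (((orAndGen δ ∩ refl (orAndGen δ) ∩ secR B x ∩ refl (secR A x)).card : ℤ) + ((orAndGen δ \ refl (orAndGen δ)) ∩ secR A x ∩ secR B x).card)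
      = ind B (x.disjSum ((univ : Finset Unit).disjSum ∅)) * ind A (x.disjSum ((∅ : Finset Unit).disjSum univ))
        + ind B (x.disjSum ((∅ : Finset Unit).disjSum univ)) * ind A (x.disjSum ((univ : Finset Unit).disjSum ∅))
        + ∑ z ∈ (univ : Finset (Finset δ)).erase ∅,
            ind A (x.disjSum ((univ : Finset Unit).disjSum z)) * ind B (x.disjSum ((univ : Finset Unit).disjSum z)) := by
  rw [orAndGen_inter_refl, orAndGen_sdiff_refl, card_inter_inter_eq_sum_ind', card_inter_inter_eq_sum_ind',
    sum_union (disjoint_zProd_levels _ _), sum_zProd_eq, sum_zProd_eq, sum_zProd_eq, sum_singleton, sum_singleton, sum_singleton,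
    sum_singleton, sum_singleton]
  simp only [ind_refl, ind_secR, compl_disjSum, compl_empty, compl_univ]

omit [Nonempty δ] in
/-- First `L`-row: `#(Q ∩ (refl A)_x ∩ B_x)`. [this work] -/
theorem lrow_orAndGen₁ :
    ((orAndGen δ ∩ secR (refl A) x ∩ secR B x).card : ℤ)
      = ∑ z : Finset δ, ind A (xᶜ.disjSum ((∅ : Finset Unit).disjSum zᶜ)) * ind B (x.disjSum ((univ : Finset Unit).disjSum z))
        + ind A (xᶜ.disjSum ((univ : Finset Unit).disjSum ∅)) * ind B (x.disjSum ((∅ : Finset Unit).disjSum univ)) := by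
  rw [card_inter_inter_eq_sum_ind', orAndGen_eq_union, sum_union (disjoint_zProd_levels _ _), sum_zProd_eq, sum_zProd_eq, sum_singleton,
    sum_singleton, sum_singleton, secR_refl]
  simp only [ind_refl, ind_secR, compl_disjSum, compl_univ, compl_empty]

omit [Nonempty δ] in
/-- Second `L`-row: `#(Q ∩ A_x ∩ (refl B)_x)`. [this work] -/
theorem lrow_orAndGen₂ :
    ((orAndGen δ ∩ secR A x ∩ secR (refl B) x).card : ℤ)
      = ∑ z : Finset δ, ind A (x.disjSum ((univ : Finset Unit).disjSum z)) * ind B (xᶜ.disjSum ((∅ : Finset Unit).disjSum zᶜ))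
        + ind A (x.disjSum ((∅ : Finset Unit).disjSum univ)) * ind B (xᶜ.disjSum ((univ : Finset Unit).disjSum ∅)) := by
  rw [card_inter_inter_eq_sum_ind', orAndGen_eq_union, sum_union (disjoint_zProd_levels _ _), sum_zProd_eq, sum_zProd_eq, sum_singleton,
    sum_singleton, sum_singleton, secR_refl]
  simp only [ind_refl, ind_secR, compl_disjSum, compl_univ, compl_empty]

omit [Nonempty δ] in
/-- Third `L`-row (antipodal rows): `#(refl Q ∩ A_{xᶜ} ∩ B_{xᶜ})`. [this work] -/
theorem lrow_orAndGen₃ :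
    ((refl (orAndGen δ) ∩ secR A xᶜ ∩ secR B xᶜ).card : ℤ)
      = ∑ z : Finset δ, ind A (xᶜ.disjSum ((∅ : Finset Unit).disjSum z)) * ind B (xᶜ.disjSum ((∅ : Finset Unit).disjSum z))
        + ind A (xᶜ.disjSum ((univ : Finset Unit).disjSum ∅)) * ind B (xᶜ.disjSum ((univ : Finset Unit).disjSum ∅)) := by
  rw [card_inter_inter_eq_sum_ind', refl_orAndGen, sum_union (disjoint_zProd_levels _ _).symm, sum_zProd_eq, sum_zProd_eq, sum_singleton,
    sum_singleton, sum_singleton]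
  simp only [ind_secR]

/-- The certificate value of one row (the right-hand side of `row_orAndGen_eq_cert`). [this work] -/
def certOrAndGen : ℤ :=
  (ind A (x.disjSum ((univ : Finset Unit).disjSum ∅)) - ind A (xᶜ.disjSum ((univ : Finset Unit).disjSum ∅)))
      * (ind B (x.disjSum ((∅ : Finset Unit).disjSum univ)) - ind B (xᶜ.disjSum ((∅ : Finset Unit).disjSum ∅)))
  + (ind A (x.disjSum ((∅ : Finset Unit).disjSum univ)) - ind A (xᶜ.disjSum ((∅ : Finset Unit).disjSum ∅)))
      * (ind B (x.disjSum ((univ : Finset Unit).disjSum ∅)) - ind B (xᶜ.disjSum ((univ : Finset Unit).disjSum ∅)))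
  + ∑ z ∈ (univ : Finset (Finset δ)).erase ∅,
      (ind A (x.disjSum ((univ : Finset Unit).disjSum z)) - ind A (xᶜ.disjSum ((∅ : Finset Unit).disjSum z)))
        * (ind B (x.disjSum ((univ : Finset Unit).disjSum z)) - ind B (xᶜ.disjSum ((∅ : Finset Unit).disjSum z)))
  + (ind A (xᶜ.disjSum ((univ : Finset Unit).disjSum ∅)) - ind A (xᶜ.disjSum ((∅ : Finset Unit).disjSum ∅)))
      * (ind B (xᶜ.disjSum ((univ : Finset Unit).disjSum ∅)) - ind B (xᶜ.disjSum ((∅ : Finset Unit).disjSum ∅)))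
  + ∑ z : Finset δ, ind A (x.disjSum ((univ : Finset Unit).disjSum z))
      * (ind B (xᶜ.disjSum ((∅ : Finset Unit).disjSum z)) - ind B (xᶜ.disjSum ((∅ : Finset Unit).disjSum zᶜ)))
  + ∑ z : Finset δ, ind B (x.disjSum ((univ : Finset Unit).disjSum z))
      * (ind A (xᶜ.disjSum ((∅ : Finset Unit).disjSum z)) - ind A (xᶜ.disjSum ((∅ : Finset Unit).disjSum zᶜ)))

/-- **The certificate identity for one row** of `P₁ ∧ orAndGen δ`:
`score-row − L-rows = certOrAndGen` (a pointwise identity under `Σ_z` plus a boundary identity). [this work] -/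
theorem row_orAndGen_eq_cert :
    (((orAndGen δ ∩ refl (orAndGen δ) ∩ secR B x ∩ refl (secR A x)).card : ℤ) + ((orAndGen δ \ refl (orAndGen δ)) ∩ secR A x ∩ secR B x).card)
      - ((orAndGen δ ∩ secR (refl A) x ∩ secR B x).card : ℤ) - ((orAndGen δ ∩ secR A x ∩ secR (refl B) x).card : ℤ)
      + ((refl (orAndGen δ) ∩ secR A xᶜ ∩ secR B xᶜ).card : ℤ) = certOrAndGen A B x := by
  rw [score_row_orAndGen, lrow_orAndGen₁, lrow_orAndGen₂, lrow_orAndGen₃]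
  unfold certOrAndGen
  rw [sum_erase_eq_sub (mem_univ _), sum_erase_eq_sub (mem_univ _)]
  have hsum : ∑ z : Finset δ, ind A (x.disjSum ((univ : Finset Unit).disjSum z)) * ind B (x.disjSum ((univ : Finset Unit).disjSum z))
      - ∑ z : Finset δ, ind A (xᶜ.disjSum ((∅ : Finset Unit).disjSum zᶜ)) * ind B (x.disjSum ((univ : Finset Unit).disjSum z))
      - ∑ z : Finset δ, ind A (x.disjSum ((univ : Finset Unit).disjSum z)) * ind B (xᶜ.disjSum ((∅ : Finset Unit).disjSum zᶜ))
      + ∑ z : Finset δ, ind A (xᶜ.disjSum ((∅ : Finset Unit).disjSum z)) * ind B (xᶜ.disjSum ((∅ : Finset Unit).disjSum z))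
      = ∑ z : Finset δ, (ind A (x.disjSum ((univ : Finset Unit).disjSum z)) - ind A (xᶜ.disjSum ((∅ : Finset Unit).disjSum z)))
            * (ind B (x.disjSum ((univ : Finset Unit).disjSum z)) - ind B (xᶜ.disjSum ((∅ : Finset Unit).disjSum z)))
        + ∑ z : Finset δ, ind A (x.disjSum ((univ : Finset Unit).disjSum z))
            * (ind B (xᶜ.disjSum ((∅ : Finset Unit).disjSum z)) - ind B (xᶜ.disjSum ((∅ : Finset Unit).disjSum zᶜ)))
        + ∑ z : Finset δ, ind B (x.disjSum ((univ : Finset Unit).disjSum z))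
            * (ind A (xᶜ.disjSum ((∅ : Finset Unit).disjSum z)) - ind A (xᶜ.disjSum ((∅ : Finset Unit).disjSum zᶜ))) := by
    rw [← sum_sub_distrib, ← sum_sub_distrib, ← sum_add_distrib, ← sum_add_distrib, ← sum_add_distrib]
    exact sum_congr rfl fun z _ => by ring
  linear_combination hsum

end rows

/-! ### The row decomposition and the theorem -/

/-- A Kleitman sum on the sections: `Σ_z [x ⊔ (⊤,z) ∈ A] ([xᶜ ⊔ (∅,z) ∈ B] − [xᶜ ⊔ (∅,zᶜ) ∈ B]) ≥ 0`. [this work] -/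
theorem kleitman_levels_nonneg {A B : Finset (Finset (γ₁ ⊕ (Unit ⊕ δ)))} (hA : IsUpperSet (A : Set (Finset (γ₁ ⊕ (Unit ⊕ δ)))))
    (hB : IsUpperSet (B : Set (Finset (γ₁ ⊕ (Unit ⊕ δ))))) (x : Finset γ₁) :
    0 ≤ ∑ z : Finset δ, ind A (x.disjSum ((univ : Finset Unit).disjSum z))
      * (ind B (xᶜ.disjSum ((∅ : Finset Unit).disjSum z)) - ind B (xᶜ.disjSum ((∅ : Finset Unit).disjSum zᶜ))) := by
  have hX : IsUpperSet ((secR (secR B xᶜ) (∅ : Finset Unit)) : Set (Finset δ)) := isUpperSet_secR (isUpperSet_secR hB xᶜ) ∅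
  have hY : IsUpperSet ((secR (secR A x) (univ : Finset Unit)) : Set (Finset δ)) := isUpperSet_secR (isUpperSet_secR hA x) univ
  have hk := klShell_univ (secR (secR B xᶜ) (∅ : Finset Unit)) (secR (secR A x) (univ : Finset Unit)) hX hY
  rw [klL_eq_sum_ind] at hk
  have e : ∑ t ∈ (univ : Finset (Finset δ)), (ind (secR (secR B xᶜ) (∅ : Finset Unit)) t - ind (refl (secR (secR B xᶜ) (∅ : Finset Unit))) t)
      * ind (secR (secR A x) (univ : Finset Unit)) t
      = ∑ z : Finset δ, ind A (x.disjSum ((univ : Finset Unit).disjSum z))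
          * (ind B (xᶜ.disjSum ((∅ : Finset Unit).disjSum z)) - ind B (xᶜ.disjSum ((∅ : Finset Unit).disjSum zᶜ))) := by
    refine sum_congr rfl fun z _ => ?_
    rw [ind_refl, ind_secR, ind_secR, ind_secR, ind_secR, ind_secR, ind_secR]
    ring
  rw [e] at hk
  exact hk

section main
variable [Nonempty δ] {P₁ : Finset (Finset γ₁)} (hP : IsUpperSet (P₁ : Set (Finset γ₁))) (hd : Disjoint P₁ (refl P₁))
  (hcor : ∀ U V : Finset (Finset γ₁), IsUpperSet (U : Set (Finset γ₁)) → IsUpperSet (V : Set (Finset γ₁)) → 0 ≤ corP P₁ U V)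

omit hP hd hcor in
/-- **Row decomposition**: `Σ_B secFAScore − L_{P₁ ∧ orAndGen}(A,B) = Σ_{x∈P₁} certOrAndGen A B x`. [this work] -/
theorem scoreVal_sub_lForm_andProd_orAndGen (P₁ : Finset (Finset γ₁)) (A B : Finset (Finset (γ₁ ⊕ (Unit ⊕ δ)))) :
    scoreVal (secFAScore P₁ (orAndGen δ)) A B - lForm (andProd P₁ (orAndGen δ)) A B = ∑ x ∈ P₁, certOrAndGen A B x := by
  rw [scoreVal_secFAScore]
  unfold lForm
  rw [card_andProd_inter_inter, card_andProd_inter_inter, refl_andProd, card_andProd_inter_inter, sum_refl_eq]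
  rw [← sum_add_distrib, ← sum_sub_distrib, ← sum_sub_distrib]
  refine sum_congr rfl fun x _ => ?_
  rw [← row_orAndGen_eq_cert A B x]
  ring

include hP hd hcor

/-- **THEOREM (`AndShellLower` for `Q = x₀ ∨ ⋀_{j∈δ} x_j`).**  For every antipode-free up-set `P₁` with `Cor_{P₁} ≥ 0` on up-set pairs and all
up-sets `A, B`: `L_{P₁ ∧ orAndGen}(A,B) ≤ Σ_B secFAScore P₁ (orAndGen δ)`. [this work] -/
theorem lForm_le_scoreVal_andProd_orAndGen {A B : Finset (Finset (γ₁ ⊕ (Unit ⊕ δ)))} (hA : IsUpperSet (A : Set (Finset (γ₁ ⊕ (Unit ⊕ δ)))))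
    (hB : IsUpperSet (B : Set (Finset (γ₁ ⊕ (Unit ⊕ δ))))) :
    lForm (andProd P₁ (orAndGen δ)) A B ≤ scoreVal (secFAScore P₁ (orAndGen δ)) A B := by
  suffices h : 0 ≤ scoreVal (secFAScore P₁ (orAndGen δ)) A B - lForm (andProd P₁ (orAndGen δ)) A B by linarith
  rw [scoreVal_sub_lForm_andProd_orAndGen]
  unfold certOrAndGen
  simp only [sum_add_distrib]
  have k1 : 0 ≤ ∑ x ∈ P₁, (ind A (x.disjSum ((univ : Finset Unit).disjSum ∅)) - ind A (xᶜ.disjSum ((univ : Finset Unit).disjSum ∅)))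
      * (ind B (x.disjSum ((∅ : Finset Unit).disjSum univ)) - ind B (xᶜ.disjSum ((∅ : Finset Unit).disjSum ∅))) :=
    sum_kat_mul_kat_nonneg hP hd hcor hA hB Subset.rfl (disjSum_mono Subset.rfl (empty_subset _))
  have k2 : 0 ≤ ∑ x ∈ P₁, (ind A (x.disjSum ((∅ : Finset Unit).disjSum univ)) - ind A (xᶜ.disjSum ((∅ : Finset Unit).disjSum ∅)))
      * (ind B (x.disjSum ((univ : Finset Unit).disjSum ∅)) - ind B (xᶜ.disjSum ((univ : Finset Unit).disjSum ∅))) :=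
    sum_kat_mul_kat_nonneg hP hd hcor hA hB (disjSum_mono Subset.rfl (empty_subset _)) Subset.rfl
  have k3 : 0 ≤ ∑ x ∈ P₁, ∑ z ∈ (univ : Finset (Finset δ)).erase ∅,
      (ind A (x.disjSum ((univ : Finset Unit).disjSum z)) - ind A (xᶜ.disjSum ((∅ : Finset Unit).disjSum z)))
        * (ind B (x.disjSum ((univ : Finset Unit).disjSum z)) - ind B (xᶜ.disjSum ((∅ : Finset Unit).disjSum z))) := by
    rw [sum_comm]
    exact sum_nonneg fun z _ => sum_kat_mul_kat_nonneg hP hd hcor hA hB (disjSum_mono (empty_subset _) Subset.rfl)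
      (disjSum_mono (empty_subset _) Subset.rfl)
  have n1 : 0 ≤ ∑ x ∈ P₁, (ind A (xᶜ.disjSum ((univ : Finset Unit).disjSum ∅)) - ind A (xᶜ.disjSum ((∅ : Finset Unit).disjSum ∅)))
      * (ind B (xᶜ.disjSum ((univ : Finset Unit).disjSum ∅)) - ind B (xᶜ.disjSum ((∅ : Finset Unit).disjSum ∅))) :=
    sum_nonneg fun x _ => mul_nonneg (nW_nonneg hA (disjSum_mono (empty_subset _) Subset.rfl) x)
      (nW_nonneg hB (disjSum_mono (empty_subset _) Subset.rfl) x)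
  have f1 : 0 ≤ ∑ x ∈ P₁, ∑ z : Finset δ, ind A (x.disjSum ((univ : Finset Unit).disjSum z))
      * (ind B (xᶜ.disjSum ((∅ : Finset Unit).disjSum z)) - ind B (xᶜ.disjSum ((∅ : Finset Unit).disjSum zᶜ))) :=
    sum_nonneg fun x _ => kleitman_levels_nonneg hA hB x
  have f2 : 0 ≤ ∑ x ∈ P₁, ∑ z : Finset δ, ind B (x.disjSum ((univ : Finset Unit).disjSum z))
      * (ind A (xᶜ.disjSum ((∅ : Finset Unit).disjSum z)) - ind A (xᶜ.disjSum ((∅ : Finset Unit).disjSum zᶜ))) :=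
    sum_nonneg fun x _ => kleitman_levels_nonneg hB hA x
  linarith

/-- The sectionwise Formula-A score is a score certificate for `P₁ ∧ orAndGen δ`. [this work] -/
theorem scoreCert_andProd_orAndGen : ScoreCert (andProd P₁ (orAndGen δ)) (secFAScore P₁ (orAndGen δ)) := fun _ _ hA hB =>
  ⟨lForm_le_scoreVal_andProd_orAndGen hP hd hcor hA hB, scoreVal_secFAScore_le_uForm hP isUpperSet_orAndGen hA hB⟩

/-- **`TriWIneq` for `P₁ ∧ (x₀ ∨ x₁ ⋯ x_k)`** (all `k ≥ 1`) on every index cube, for every intersecting Kleitman shell `P₁`. [this work] -/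
theorem triW_nonneg_andProd_orAndGen (F G : Finset β → Finset (Finset (γ₁ ⊕ (Unit ⊕ δ))))
    (hF : ∀ x, IsUpperSet (F x : Set (Finset (γ₁ ⊕ (Unit ⊕ δ))))) (hG : ∀ x, IsUpperSet (G x : Set (Finset (γ₁ ⊕ (Unit ⊕ δ)))))
    (hFm : Monotone F) (hGm : Monotone G) :
    0 ≤ triW (andProd P₁ (orAndGen δ)) F G :=
  triW_nonneg_of_scoreCert (monoScore_secFAScore P₁ (orAndGen δ)) (scoreCert_andProd_orAndGen hP hd hcor) F G hF hG hFm hGm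

end main

/-- The same with the hypothesis on `P₁` in Kleitman-shell form. [this work] -/
theorem triW_nonneg_andProd_orAndGen_of_klShell [Nonempty δ] {P₁ : Finset (Finset γ₁)} (hP : IsUpperSet (P₁ : Set (Finset γ₁)))
    (hd : Disjoint P₁ (refl P₁)) (hs : KlShell (P₁ ∪ refl P₁)) (F G : Finset β → Finset (Finset (γ₁ ⊕ (Unit ⊕ δ))))
    (hF : ∀ x, IsUpperSet (F x : Set (Finset (γ₁ ⊕ (Unit ⊕ δ))))) (hG : ∀ x, IsUpperSet (G x : Set (Finset (γ₁ ⊕ (Unit ⊕ δ)))))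
    (hFm : Monotone F) (hGm : Monotone G) :
    0 ≤ triW (andProd P₁ (orAndGen δ)) F G :=
  triW_nonneg_andProd_orAndGen hP hd (fun U V hU hV => by rw [corP_eq_card_sub_card_of_disjoint hd]; exact hs U V hU hV) F G hF hG hFm hGm

end FiveUpSet

end Summit.CriticalPhenomena.PercolationContinuityZ3.Theorems
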